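import Mathlib
import Summits.ValiantsHypothesis.ValiantsHypothesis.Theorems.KPlusLogSqLawTropicalBSingleGaugeExists

/-!
# Route «KPlusLogSqLaw», crux `TropicalB` (stmt-ValiantsHypothesis-19771) — PAIR INTERPOLATION: any two dominant terms share an affine
# row gauge, so the dual-regime number of every chain satisfies `G ≤ ⌈(n+1)/2⌉`

HONEST FRAMING.  Helper file (cell `pub-symmetroid`, seat val-sym-trop-p5 g10, 2026-08-27) `--supports` the crux
`Summit.ValiantsHypothesis.ValiantsHypothesis.Theses.KPlusLogSqLaw.TropicalB` (item `stmt-ValiantsHypothesis-19771`); third companion of the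
SINGLE-GAUGE LAW (`…TropicalBSingleGauge`, p554764: `n ≤ m(G·mK − 1)` for a chain with `G` affine row-dual regimes) after
`…TropicalBSingleGaugeExists` (p556873: Egerváry potentials exist for every dominant term, so `G ≤ n + 1`).  Here the RANGE of the invariant is
pinned: interpolating the integer Egerváry potentials of two dominant terms LINEARLY in the slope gives one affine gauge certifying both
(`exists_gauge_pair`), so every dominant chain is certified by `⌊n/2⌋ + 1` gauge pieces of consecutive pairs (`exists_pairGauges_of_chain`):
**`1 ≤ G ≤ ⌊n/2⌋ + 1` for every chain.**  Located reading (memo SINGLE-GAUGE-g10.md): the structured all-`m` families of the cell sit at the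
minimum `G = 1`, the census-record chains `(4,4) / (5,4) / (6,4)` at `G = 13 / 16 / 23` of the maxima `18 / 25 / 33` — within a factor `1.5` of
maximal irregularity.  Nothing here bounds `TropicalB`; nothing bears on `TropicalB` in its window, `WeakLifting`, DoorA26 / DoorA34,
`MatrixDescartes` (stmt-ValiantsHypothesis-18050) or VP ≠ VNP.
[folklore] linear interpolation of LP duals; packaging of the cell.
-/

set_option linter.dupNamespace false
set_option autoImplicit false

namespace Summit.ValiantsHypothesis.ValiantsHypothesis.Theorems.KPlusLogSqLaw

open Summit.ValiantsHypothesis.ValiantsHypothesis.Theorems.MatrixDescartes.Negative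
open Summit.ValiantsHypothesis.ValiantsHypothesis.Theorems.LacunarySymmetroidMatrixDescartes
open Summit.ValiantsHypothesis.ValiantsHypothesis.Theorems.LacunarySymmetroidMatrixDescartes.TropicalCensus
open scoped BigOperators
open Finset

namespace SingleGauge

variable {m K : ℕ}

/-- **Pair interpolation.**  Two dominant terms `q` at `θ` and `q'` at `θ'`, `θ < θ'`, are certified column-wise by ONE common affine row
gauge: interpolate their integer Egerváry potentials `u, u'` linearly, `u_i(t) = u i + (t − θ)·(u' i − u i)/(θ' − θ)`. [folklore] -/
theorem exists_gauge_pair (d : Fin K → ℕ) (v ε : Fin m → Fin m → Fin K → ℤ) {θ θ' : ℤ} (hθ : θ < θ')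
    (q q' : Equiv.Perm (Fin m) × (Fin m → Fin K)) (hq : IsDominant d v ε θ q) (hq' : IsDominant d v ε θ' q') :
    ∃ α β : Fin m → ℚ,
      (∀ (j i : Fin m) (l : Fin K), ε i j l ≠ 0 →
        ((θ : ℚ) * (d l : ℚ) - (v i j l : ℚ)) - (α i * (θ : ℚ) + β i) ≤
          ((θ : ℚ) * (d (q.2 j) : ℚ) - (v (q.1 j) j (q.2 j) : ℚ)) - (α (q.1 j) * (θ : ℚ) + β (q.1 j))) ∧
      (∀ (j i : Fin m) (l : Fin K), ε i j l ≠ 0 →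
        ((θ' : ℚ) * (d l : ℚ) - (v i j l : ℚ)) - (α i * (θ' : ℚ) + β i) ≤
          ((θ' : ℚ) * (d (q'.2 j) : ℚ) - (v (q'.1 j) j (q'.2 j) : ℚ)) - (α (q'.1 j) * (θ' : ℚ) + β (q'.1 j))) := by
  obtain ⟨u, hu⟩ := exists_rowGauge_of_isDominant d v ε θ q hq
  obtain ⟨u', hu'⟩ := exists_rowGauge_of_isDominant d v ε θ' q' hq'
  have hδ : (0 : ℚ) < (θ' : ℚ) - (θ : ℚ) := by
    have : (θ : ℚ) < (θ' : ℚ) := by exact_mod_cast hθ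
    linarith
  have hδ0 : (θ' : ℚ) - (θ : ℚ) ≠ 0 := ne_of_gt hδ
  -- the interpolating gauge
  refine ⟨fun i => ((u' i : ℚ) - (u i : ℚ)) / ((θ' : ℚ) - (θ : ℚ)),
    fun i => (u i : ℚ) - ((u' i : ℚ) - (u i : ℚ)) / ((θ' : ℚ) - (θ : ℚ)) * (θ : ℚ), ?_, ?_⟩
  · -- at θ the gauge is u
    intro j i l hil
    have hval : ∀ i : Fin m, ((u' i : ℚ) - (u i : ℚ)) / ((θ' : ℚ) - (θ : ℚ)) * (θ : ℚ) +
        ((u i : ℚ) - ((u' i : ℚ) - (u i : ℚ)) / ((θ' : ℚ) - (θ : ℚ)) * (θ : ℚ)) = (u i : ℚ) := fun i => by ring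
    rw [hval, hval]
    have h := hu j i l hil
    have h' : (((θ * (d l : ℤ) - v i j l) - u i : ℤ) : ℚ) ≤ (((θ * (d (q.2 j) : ℤ) - v (q.1 j) j (q.2 j)) - u (q.1 j) : ℤ) : ℚ) := by
      exact_mod_cast h
    push_cast at h'
    linarith
  · -- at θ' the gauge is u'
    intro j i l hil
    have hval : ∀ i : Fin m, ((u' i : ℚ) - (u i : ℚ)) / ((θ' : ℚ) - (θ : ℚ)) * (θ' : ℚ) +
        ((u i : ℚ) - ((u' i : ℚ) - (u i : ℚ)) / ((θ' : ℚ) - (θ : ℚ)) * (θ : ℚ)) = (u' i : ℚ) := by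
      intro i
      have : ((u' i : ℚ) - (u i : ℚ)) / ((θ' : ℚ) - (θ : ℚ)) * ((θ' : ℚ) - (θ : ℚ)) = (u' i : ℚ) - (u i : ℚ) :=
        div_mul_cancel₀ _ hδ0
      linear_combination this
    rw [hval, hval]
    have h := hu' j i l hil
    have h' : (((θ' * (d l : ℤ) - v i j l) - u' i : ℤ) : ℚ) ≤
        (((θ' * (d (q'.2 j) : ℤ) - v (q'.1 j) j (q'.2 j)) - u' (q'.1 j) : ℤ) : ℚ) := by
      exact_mod_cast h
    push_cast at h'
    linarith

/-- **Every dominant chain is certified by consecutive-pair gauges**: with `G = ⌊n/2⌋ + 1` pieces `{2t, 2t+1}` (monotone label `k ↦ ⌊k/2⌋`),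
the hypothesis of `SingleGauge.chain_le_of_gaugePieces` holds.  Hence the dual-regime number of every dominant chain lies in `[1, ⌊n/2⌋ + 1]`.
[folklore; packaging of the cell] -/
theorem exists_pairGauges_of_chain (d : Fin K → ℕ) (v ε : Fin m → Fin m → Fin K → ℤ) {n : ℕ}
    (θ : Fin (n + 1) → ℤ) (hθ : StrictMono θ) (p : Fin (n + 1) → Equiv.Perm (Fin m) × (Fin m → Fin K))
    (hdom : ∀ k, IsDominant d v ε (θ k) (p k)) :
    ∃ (g : Fin (n + 1) → Fin (n / 2 + 1)) (α β : Fin (n / 2 + 1) → Fin m → ℚ), Monotone g ∧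
      ∀ (k : Fin (n + 1)) (j i : Fin m) (l : Fin K), ε i j l ≠ 0 →
        ((θ k : ℚ) * (d l : ℚ) - (v i j l : ℚ)) - (α (g k) i * (θ k : ℚ) + β (g k) i) ≤
          ((θ k : ℚ) * (d ((p k).2 j) : ℚ) - (v ((p k).1 j) j ((p k).2 j) : ℚ)) -
            (α (g k) ((p k).1 j) * (θ k : ℚ) + β (g k) ((p k).1 j)) := by
  -- the two members of piece t
  let k₁ : Fin (n / 2 + 1) → Fin (n + 1) := fun t => ⟨2 * t.val, by omega⟩
  let k₂ : Fin (n / 2 + 1) → Fin (n + 1) := fun t => ⟨min (2 * t.val + 1) n, by omega⟩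
  -- one gauge per piece certifying both members
  have hpiece : ∀ t : Fin (n / 2 + 1), ∃ α β : Fin m → ℚ,
      (∀ (j i : Fin m) (l : Fin K), ε i j l ≠ 0 →
        ((θ (k₁ t) : ℚ) * (d l : ℚ) - (v i j l : ℚ)) - (α i * (θ (k₁ t) : ℚ) + β i) ≤
          ((θ (k₁ t) : ℚ) * (d ((p (k₁ t)).2 j) : ℚ) - (v ((p (k₁ t)).1 j) j ((p (k₁ t)).2 j) : ℚ)) -
            (α ((p (k₁ t)).1 j) * (θ (k₁ t) : ℚ) + β ((p (k₁ t)).1 j))) ∧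
      (∀ (j i : Fin m) (l : Fin K), ε i j l ≠ 0 →
        ((θ (k₂ t) : ℚ) * (d l : ℚ) - (v i j l : ℚ)) - (α i * (θ (k₂ t) : ℚ) + β i) ≤
          ((θ (k₂ t) : ℚ) * (d ((p (k₂ t)).2 j) : ℚ) - (v ((p (k₂ t)).1 j) j ((p (k₂ t)).2 j) : ℚ)) -
            (α ((p (k₂ t)).1 j) * (θ (k₂ t) : ℚ) + β ((p (k₂ t)).1 j))) := by
    intro t
    by_cases hlt : k₁ t < k₂ t
    · exact exists_gauge_pair d v ε (hθ hlt) (p (k₁ t)) (p (k₂ t)) (hdom _) (hdom _)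
    · -- the piece is a singleton: k₂ t = k₁ t
      have heq : k₂ t = k₁ t := by
        apply Fin.ext
        have h1 : ¬ (2 * t.val) < min (2 * t.val + 1) n := fun h => hlt (Fin.lt_def.mpr h)
        show min (2 * t.val + 1) n = 2 * t.val
        have := t.isLt
        omega
      obtain ⟨u, hu⟩ := exists_rowGauge_of_isDominant d v ε (θ (k₁ t)) (p (k₁ t)) (hdom _)
      refine ⟨fun _ => 0, fun i => (u i : ℚ), ?_, ?_⟩
      · intro j i l hil
        have h := hu j i l hil
        have h' : ((((θ (k₁ t)) * (d l : ℤ) - v i j l) - u i : ℤ) : ℚ) ≤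
            ((((θ (k₁ t)) * (d ((p (k₁ t)).2 j) : ℤ) - v ((p (k₁ t)).1 j) j ((p (k₁ t)).2 j)) - u ((p (k₁ t)).1 j) : ℤ) : ℚ) := by
          exact_mod_cast h
        push_cast at h'
        linarith
      · rw [heq]
        intro j i l hil
        have h := hu j i l hil
        have h' : ((((θ (k₁ t)) * (d l : ℤ) - v i j l) - u i : ℤ) : ℚ) ≤
            ((((θ (k₁ t)) * (d ((p (k₁ t)).2 j) : ℤ) - v ((p (k₁ t)).1 j) j ((p (k₁ t)).2 j)) - u ((p (k₁ t)).1 j) : ℤ) : ℚ) := by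
          exact_mod_cast h
        push_cast at h'
        linarith
  choose α β hα₁ hα₂ using hpiece
  refine ⟨fun k => ⟨k.val / 2, by omega⟩, α, β, ?_, ?_⟩
  · intro k k' hkk'
    show (⟨k.val / 2, _⟩ : Fin (n / 2 + 1)) ≤ ⟨k'.val / 2, _⟩
    rw [Fin.le_def]
    exact Nat.div_le_div_right (Fin.le_def.mp hkk')
  · intro k j i l hil
    -- k is one of the two members of its piece
    set t : Fin (n / 2 + 1) := ⟨k.val / 2, by omega⟩ with ht
    rcases Nat.even_or_odd k.val with ⟨r, hr⟩ | ⟨r, hr⟩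
    · have hk : k = k₁ t := by
        apply Fin.ext
        show k.val = 2 * (k.val / 2)
        omega
      have h := hα₁ t j i l hil
      rw [← hk] at h
      exact h
    · have hk : k = k₂ t := by
        apply Fin.ext
        show k.val = min (2 * (k.val / 2) + 1) n
        have := k.isLt
        omega
      have h := hα₂ t j i l hil
      rw [← hk] at h
      exact h

end SingleGauge

end Summit.ValiantsHypothesis.ValiantsHypothesis.Theorems.KPlusLogSqLaw
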